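import Summits.CriticalPhenomena.PercolationContinuityZ3.Theorems.PercNearOneGluingNoHeavyLowerTailMajorityGluingEight
import Summits.CriticalPhenomena.PercolationContinuityZ3.Theorems.PercNearOneGluingNoHeavyLowerTailMajorityGluingSevenTwo
import HarnessLib

/-!
# Majority gluing at `|A| ∈ {8, 9}`: loss `(7/3)·max`, and `2·max` whenever `max ≥ 1/4` — from a constant cell bound through Harris (lane prim-rate, constants-miner 1, gen 32; CANDIDATES §GEN-32 R317)

Support file for the closed crux `NoHeavyLowerTail` (stmt-CriticalPhenomena-4575), majority-gluing line.  GENERIC LAYER: if at a relay set `A ∋ a₀`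
(`|A| ≥ 2`) every cell `T ⊆ A ∖ {a₀}`, `|T| + 2 = |A|`, obeys a CONSTANT bound `μ(⌈|A|/2⌉ ≤ #cut T) ≤ c·δ` (`δ ≥` the cut probabilities on `T`,
`c ≥ 1`), then for every weight function, observer `o` and `δ₀ ≥ max_{a∈A} μ(a ↮ a₀)`:
* `μ(o ↔ A) − μ(o ↔ a₀ ∧ 2N > |A|) ≤ δ₀ + c·δ₀·(1 − δ₀)` when `c·δ₀ ≤ 1` (`majorityGluing_harris_of_cellConst`: peel a relay `c' ≠ a₀`,
  `H_a ⊆ {c' ↮ a₀} ∪ ({c' ↔ a₀} ∩ {⌈|A|/2⌉ ≤ #cut})`, Harris for increasing × decreasing, closure over degenerate weights — the mechanism of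
  `…MajorityGluingSixHarris`, made generic in `|A|` and `c`);
* hence loss `2·δ₀` whenever `c·(1 − δ₀) ≤ 1` (`majorityGluing_two_of_cellConst`) and loss `(1 + c)·δ₀` always (`majorityGluing_of_cellConst`).
INSTANCES from `fourOfSix_count` (`c = 4/3` at the root cell `R_4 = (6,4)`, gen 32) and the cell monotonicity `cutCount_mono` (`(6,4) ⟹ (7,5)`):
for `8 ≤ |A| ≤ 9`, **`C(|A|) ≤ 7/3`** (`majorityGluing_card_eight_nine`; the tree had `5/2` and `12/5` from additive gluing),
**`μ(o ↔ A) − μ(o ↔ a₀ ∧ 2N > |A|) ≤ δ₀ + (4/3)δ₀(1 − δ₀)`** for `δ₀ ≤ 3/4` (`majorityGluing_harris_card_eight_nine`) and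
**`C(8) = C(9) = 2` whenever `max ≥ 1/4`** (`majorityGluing_two_card_eight_nine_of_ge`).  The window `max < 1/4` of `R_4` stays open
(it is where a six-relay kernel programme would have to work; the `(4,3)` window was `max < 13/256`).
No definitions, no named facts, no sorries. [cite: VandenbergKahn2001, Thm 1.2 (p. 123)] [cite: KozmaNitzan2024, Conj. 1 (p. 3), Conj. 4 (p. 32)]
-/

noncomputable section

namespace Summit.CriticalPhenomena.PercolationContinuityZ3.Theorems

open MeasureTheory Set
open Literature.Probability.LatticeModels
open Literature.Probability.Percolation
open scoped Classical

namespace HubOnly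

variable {n : ℕ}

/-! ### Generic: a constant cell bound through Harris -/

/-- **Hub event from a constant cell bound, with Harris** (non-degenerate weights not needed here): if every cell `T ⊆ A ∖ {a₀}` with
`|T| + 2 = |A|` has `μ(⌈|A|/2⌉ ≤ #cut T) ≤ c·δ` for every `δ ≥ 0` bounding the cut probabilities on `T`, then for every `a ∈ A`
(`|A| ≥ 2`, `M = max_{a'∈A} μ(a' ↮ a₀)`):  `μ(H_a) ≤ M + (1 − M)·min(1, c·M)`. [cite: VandenbergKahn2001, Thm 1.2 (p. 123)] -/
theorem hubEvent_harris_of_cellConst (p : Sym2 (Fin n) → unitInterval) (A : Finset (Fin n)) (a₀ a : Fin n)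
    (ha₀ : a₀ ∈ A) (ha : a ∈ A) (hA : 2 ≤ A.card) (c : ℝ)
    (hcell : ∀ (T : Finset (Fin n)) (δ : ℝ), a₀ ∉ T → T ⊆ A → T.card + 2 = A.card → 0 ≤ δ →
      (∀ v ∈ T, (prodBernoulli p).real (openConn v a₀ : Set (BondConfig (Fin n)))ᶜ ≤ δ) →
      (prodBernoulli p).real {ω : BondConfig (Fin n) | (A.card + 1) / 2 ≤ (T.filter fun v => ω ∉ openConn v a₀).card} ≤ c * δ) :
    (prodBernoulli p).real {ω : BondConfig (Fin n) | ω ∈ openConn a a₀ →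
        2 * (A.filter fun a' => ω ∈ openConn a' a₀).card ≤ A.card}
      ≤ A.sup' ⟨a₀, ha₀⟩ (fun a' => (prodBernoulli p).real (openConn a' a₀ : Set (BondConfig (Fin n)))ᶜ) +
        (1 - A.sup' ⟨a₀, ha₀⟩ (fun a' => (prodBernoulli p).real (openConn a' a₀ : Set (BondConfig (Fin n)))ᶜ)) *
          min 1 (c * A.sup' ⟨a₀, ha₀⟩ (fun a' => (prodBernoulli p).real (openConn a' a₀ : Set (BondConfig (Fin n)))ᶜ)) := by
  set μ := prodBernoulli p with hμ
  have hms : ∀ S : Set (BondConfig (Fin n)), MeasurableSet S := fun _ => MeasurableSet.of_discrete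
  set δ : Fin n → ℝ := fun x => μ.real (openConn x a₀ : Set (BondConfig (Fin n)))ᶜ with hδ
  set M := A.sup' ⟨a₀, ha₀⟩ δ with hM
  have hδle : ∀ x ∈ A, δ x ≤ M := fun x hx => Finset.le_sup' δ hx
  have hM0 : 0 ≤ M := le_trans measureReal_nonneg (hδle a₀ ha₀)
  -- the auxiliary relay `c' ≠ a₀`, equal to `a` unless `a = a₀`
  obtain ⟨c', hcA, hca₀, hca⟩ : ∃ c' ∈ A, c' ≠ a₀ ∧ (a ≠ a₀ → c' = a) := by
    by_cases haa : a = a₀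
    · obtain ⟨c', hc', hne⟩ := Finset.exists_mem_ne hA a₀
      exact ⟨c', hc', hne, fun h => (h haa).elim⟩
    · exact ⟨a, ha, haa, fun _ => rfl⟩
  set T : Finset (Fin n) := (A.erase a₀).erase c' with hT
  set hh : ℕ := (A.card + 1) / 2 with hhh
  have hcT : c' ∈ A.erase a₀ := Finset.mem_erase.2 ⟨hca₀, hcA⟩
  have hTcard : T.card + 2 = A.card := by
    rw [hT, Finset.card_erase_of_mem hcT, Finset.card_erase_of_mem ha₀]
    omega
  have hTA : T ⊆ A := (Finset.erase_subset _ _).trans (Finset.erase_subset _ _)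
  have ha₀T : a₀ ∉ T := fun h' => Finset.ne_of_mem_erase (Finset.mem_of_mem_erase h') rfl |>.elim
  set K : Set (BondConfig (Fin n)) := {ω | hh ≤ (T.filter fun v => ω ∉ openConn v a₀).card} with hK
  -- `H_a ⊆ {c' ↮ a₀} ∪ ({c' ↔ a₀} ∩ K)`
  have hsub : {ω : BondConfig (Fin n) | ω ∈ openConn a a₀ → 2 * (A.filter fun a' => ω ∈ openConn a' a₀).card ≤ A.card} ⊆
      (openConn c' a₀ : Set (BondConfig (Fin n)))ᶜ ∪ ((openConn c' a₀ : Set (BondConfig (Fin n))) ∩ K) := by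
    intro ω hω
    by_cases hcc : ω ∈ openConn c' a₀
    · right
      refine ⟨hcc, ?_⟩
      have haa : ω ∈ openConn a a₀ := by
        by_cases h' : a = a₀
        · rw [h']; exact (SimpleGraph.Reachable.refl _ : (openGraph ω).Reachable a₀ a₀)
        · rw [← hca h']; exact hcc
      have hle := hω haa
      have hsplit := Finset.card_filter_add_card_filter_not (s := A) (fun a' => ω ∈ openConn a' a₀)
      have hcut : (A.filter fun a' => ¬ ω ∈ openConn a' a₀) ⊆ T.filter fun v => ω ∉ openConn v a₀ := by
        intro x hx
        rw [Finset.mem_filter] at hx ⊢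
        refine ⟨?_, hx.2⟩
        rw [hT, Finset.mem_erase, Finset.mem_erase]
        refine ⟨?_, ?_, hx.1⟩
        · rintro rfl; exact hx.2 hcc
        · rintro rfl; exact hx.2 (SimpleGraph.Reachable.refl _ : (openGraph ω).Reachable x x)
      have hc2 := Finset.card_le_card hcut
      simp only [hK, mem_setOf_eq]
      omega
    · left; exact hcc
  -- the cell bound for `K`, capped by `1`, and Harris for `{c' ↔ a₀} ∩ K`
  have hKb : μ.real K ≤ min 1 (c * M) :=
    le_min measureReal_le_one (hcell T M ha₀T hTA hTcard hM0 (fun v hv => hδle v (hTA hv)))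
  have hHarris : μ.real ((openConn c' a₀ : Set (BondConfig (Fin n))) ∩ K) ≤
      μ.real (openConn c' a₀ : Set (BondConfig (Fin n))) * μ.real K :=
    Literature.Probability.LatticeModels.prodBernoulli_harris_upper_lower p (isUpperSet_openConn c' a₀)
      (isLowerSet_thresholdCut T a₀ hh) (hms _) (hms _)
  have hconn : μ.real (openConn c' a₀ : Set (BondConfig (Fin n))) = 1 - δ c' := by
    have := probReal_compl_eq_one_sub (μ := μ) (hms (openConn c' a₀ : Set (BondConfig (Fin n))))
    simp only [hδ]; linarith
  have hδc : δ c' ≤ M := hδle c' hcA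
  have hδc0 : 0 ≤ δ c' := measureReal_nonneg
  have hK0 : 0 ≤ μ.real K := measureReal_nonneg
  have hk1 : min 1 (c * M) ≤ (1 : ℝ) := min_le_left _ _
  calc μ.real {ω : BondConfig (Fin n) | ω ∈ openConn a a₀ → 2 * (A.filter fun a' => ω ∈ openConn a' a₀).card ≤ A.card}
      ≤ μ.real ((openConn c' a₀ : Set (BondConfig (Fin n)))ᶜ ∪ ((openConn c' a₀ : Set (BondConfig (Fin n))) ∩ K)) :=
        measureReal_mono hsub
    _ ≤ μ.real (openConn c' a₀ : Set (BondConfig (Fin n)))ᶜ + μ.real ((openConn c' a₀ : Set (BondConfig (Fin n))) ∩ K) :=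
        measureReal_union_le _ _
    _ ≤ δ c' + (1 - δ c') * μ.real K := by rw [← hconn]; exact add_le_add le_rfl hHarris
    _ ≤ δ c' + (1 - δ c') * min 1 (c * M) :=
        add_le_add le_rfl (mul_le_mul_of_nonneg_left hKb (by linarith [(measureReal_le_one : δ c' ≤ 1)]))
    _ ≤ M + (1 - M) * min 1 (c * M) := by
        nlinarith [mul_nonneg (sub_nonneg.2 hδc) (sub_nonneg.2 hk1)]

/-- **MAJORITY GLUING FROM A CONSTANT CELL BOUND, WITH HARRIS.**  If at EVERY non-degenerate weight function the cells of `A` (size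
`|A| − 2`, threshold `⌈|A|/2⌉`) obey `μ(⌈|A|/2⌉ ≤ #cut T) ≤ c·δ` (`c ≥ 1`), then for every weight function, observer `o`, hub `a₀ ∈ A`
(`|A| ≥ 2`) and `δ₀ ≥ max_{a∈A} μ(a ↮ a₀)` with `c·δ₀ ≤ 1`:  `μ(o ↔ A) − μ(o ↔ a₀ ∧ 2N > |A|) ≤ δ₀ + c·δ₀·(1 − δ₀)`
(closure over degenerate weights by continuity; monotonicity of `x ↦ x + c x (1 − x)` on `[0, 1/c]`).
[cite: VandenbergKahn2001, Thm 1.2 (p. 123)] [cite: KozmaNitzan2024, Conj. 1 (p. 3)] -/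
theorem majorityGluing_harris_of_cellConst (w : Sym2 (Fin n) → unitInterval) (A : Finset (Fin n)) (o a₀ : Fin n) (δ₀ : ℝ)
    (ha₀ : a₀ ∈ A) (hA : 2 ≤ A.card) (c : ℝ) (hc1 : 1 ≤ c)
    (hcell : ∀ (p : Sym2 (Fin n) → unitInterval), (∀ e, 0 < p e ∧ p e < 1) →
      ∀ (T : Finset (Fin n)) (δ : ℝ), a₀ ∉ T → T ⊆ A → T.card + 2 = A.card → 0 ≤ δ →
      (∀ v ∈ T, (prodBernoulli p).real (openConn v a₀ : Set (BondConfig (Fin n)))ᶜ ≤ δ) →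
      (prodBernoulli p).real {ω : BondConfig (Fin n) | (A.card + 1) / 2 ≤ (T.filter fun v => ω ∉ openConn v a₀).card} ≤ c * δ)
    (hδ₀ : ∀ a ∈ A, (prodBernoulli w).real (openConn a a₀ : Set (BondConfig (Fin n)))ᶜ ≤ δ₀) (hcδ : c * δ₀ ≤ 1) :
    (prodBernoulli w).real (⋃ a ∈ A, openConn o a) -
        (prodBernoulli w).real {ω : BondConfig (Fin n) | ω ∈ openConn o a₀ ∧
          A.card < 2 * (A.filter fun a => ω ∈ openConn o a).card}
      ≤ δ₀ + c * δ₀ * (1 - δ₀) := by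
  have hc : 0 ≤ c := le_trans zero_le_one hc1
  set f : (Sym2 (Fin n) → unitInterval) → ℝ := fun p =>
    (prodBernoulli p).real (⋃ a ∈ A, openConn o a) -
        (prodBernoulli p).real {ω : BondConfig (Fin n) | ω ∈ openConn o a₀ ∧
          A.card < 2 * (A.filter fun a => ω ∈ openConn o a).card} with hf
  set Mf : (Sym2 (Fin n) → unitInterval) → ℝ := fun p =>
    A.sup' ⟨a₀, ha₀⟩ (fun a' => (prodBernoulli p).real (openConn a' a₀ : Set (BondConfig (Fin n)))ᶜ) with hMf
  set g : (Sym2 (Fin n) → unitInterval) → ℝ := fun p => Mf p + (1 - Mf p) * min 1 (c * Mf p) with hg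
  have hfc : Continuous f := (prodBernoulli_real_continuous _).sub (prodBernoulli_real_continuous _)
  have hMc : Continuous Mf := Continuous.finset_sup'_apply _ fun a' _ => prodBernoulli_real_continuous _
  have hgc : Continuous g :=
    hMc.add ((continuous_const.sub hMc).mul (continuous_const.min (continuous_const.mul hMc)))
  have hfg : ∀ p : Sym2 (Fin n) → unitInterval, (∀ e, 0 < p e ∧ p e < 1) → f p ≤ g p := by
    intro p hp
    obtain ⟨a, haA, hle⟩ := deficit_le_hubEvent p hp A o a₀ ha₀
    exact hle.trans (hubEvent_harris_of_cellConst p A a₀ a ha₀ haA hA c (hcell p hp))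
  have hw := weights_le_of_forall_pos_lt_one hfc hgc hfg w
  -- `g w ≤ δ₀ + c δ₀ (1 - δ₀)` by monotonicity on `[0, 1/c]`
  have hMw : Mf w ≤ δ₀ := Finset.sup'_le _ _ fun a' ha' => hδ₀ a' ha'
  have hMw0 : 0 ≤ Mf w := le_trans measureReal_nonneg (Finset.le_sup' (fun a' => (prodBernoulli w).real
    (openConn a' a₀ : Set (BondConfig (Fin n)))ᶜ) ha₀)
  have hcM : c * Mf w ≤ 1 := le_trans (mul_le_mul_of_nonneg_left hMw hc) hcδ
  have hmin : min 1 (c * Mf w) = c * Mf w := min_eq_right hcM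
  have hgw : g w = Mf w + c * Mf w * (1 - Mf w) := by simp only [hg, hmin]; ring
  have hmono : Mf w + c * Mf w * (1 - Mf w) ≤ δ₀ + c * δ₀ * (1 - δ₀) := by
    -- (δ₀ − M)(1 + c − c(δ₀ + M)) ≥ 0 since c(δ₀ + M) ≤ 2 ≤ 1 + c
    have h1 : c * (δ₀ + Mf w) ≤ 2 := by nlinarith
    nlinarith [mul_nonneg (sub_nonneg.2 hMw) (show (0 : ℝ) ≤ 1 + c - c * (δ₀ + Mf w) by linarith)]
  calc f w ≤ g w := hw
    _ = Mf w + c * Mf w * (1 - Mf w) := hgw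
    _ ≤ δ₀ + c * δ₀ * (1 - δ₀) := hmono

/-- **Loss `2·max` from a constant cell bound in the Harris regime `c·(1 − δ₀) ≤ 1`** (and `c ≥ 1`, `|A| ≥ 2`):
`μ(o ↔ A) − 2δ₀ ≤ μ(o ↔ a₀ ∧ 2N > |A|)`. [cite: VandenbergKahn2001, Thm 1.2 (p. 123)] [cite: KozmaNitzan2024, Conj. 1 (p. 3)] -/
theorem majorityGluing_two_of_cellConst (w : Sym2 (Fin n) → unitInterval) (A : Finset (Fin n)) (o a₀ : Fin n) (δ₀ : ℝ)
    (ha₀ : a₀ ∈ A) (hA : 2 ≤ A.card) (c : ℝ) (hc1 : 1 ≤ c)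
    (hcell : ∀ (p : Sym2 (Fin n) → unitInterval), (∀ e, 0 < p e ∧ p e < 1) →
      ∀ (T : Finset (Fin n)) (δ : ℝ), a₀ ∉ T → T ⊆ A → T.card + 2 = A.card → 0 ≤ δ →
      (∀ v ∈ T, (prodBernoulli p).real (openConn v a₀ : Set (BondConfig (Fin n)))ᶜ ≤ δ) →
      (prodBernoulli p).real {ω : BondConfig (Fin n) | (A.card + 1) / 2 ≤ (T.filter fun v => ω ∉ openConn v a₀).card} ≤ c * δ)
    (hδ₀ : ∀ a ∈ A, (prodBernoulli w).real (openConn a a₀ : Set (BondConfig (Fin n)))ᶜ ≤ δ₀) (hreg : c * (1 - δ₀) ≤ 1) :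
    (prodBernoulli w).real (⋃ a ∈ A, openConn o a) - 2 * δ₀ ≤
      (prodBernoulli w).real {ω : BondConfig (Fin n) | ω ∈ openConn o a₀ ∧
          A.card < 2 * (A.filter fun a => ω ∈ openConn o a).card} := by
  have hδ₀0 : 0 ≤ δ₀ := le_trans measureReal_nonneg (hδ₀ a₀ ha₀)
  by_cases hsmall : c * δ₀ ≤ 1
  · have h := majorityGluing_harris_of_cellConst w A o a₀ δ₀ ha₀ hA c hc1 hcell hδ₀ hsmall
    have : δ₀ + c * δ₀ * (1 - δ₀) ≤ 2 * δ₀ := by nlinarith [mul_nonneg hδ₀0 (sub_nonneg.2 hreg)]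
    linarith
  · have h1 : (prodBernoulli w).real (⋃ a ∈ A, openConn o a) ≤ 1 := measureReal_le_one
    have h0 : 0 ≤ (prodBernoulli w).real {ω : BondConfig (Fin n) | ω ∈ openConn o a₀ ∧
        A.card < 2 * (A.filter fun a => ω ∈ openConn o a).card} := measureReal_nonneg
    push Not at hsmall
    have : 1 ≤ 2 * δ₀ := by nlinarith
    linarith

/-- **Loss `(1 + c)·max` from a constant cell bound `c ≥ 1`, unconditionally** (`|A| ≥ 2`):
`μ(o ↔ A) − (1 + c)δ₀ ≤ μ(o ↔ a₀ ∧ 2N > |A|)`. [cite: VandenbergKahn2001, Thm 1.2 (p. 123)] [cite: KozmaNitzan2024, Conj. 1 (p. 3)] -/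
theorem majorityGluing_of_cellConst (w : Sym2 (Fin n) → unitInterval) (A : Finset (Fin n)) (o a₀ : Fin n) (δ₀ : ℝ)
    (ha₀ : a₀ ∈ A) (hA : 2 ≤ A.card) (c : ℝ) (hc1 : 1 ≤ c)
    (hcell : ∀ (p : Sym2 (Fin n) → unitInterval), (∀ e, 0 < p e ∧ p e < 1) →
      ∀ (T : Finset (Fin n)) (δ : ℝ), a₀ ∉ T → T ⊆ A → T.card + 2 = A.card → 0 ≤ δ →
      (∀ v ∈ T, (prodBernoulli p).real (openConn v a₀ : Set (BondConfig (Fin n)))ᶜ ≤ δ) →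
      (prodBernoulli p).real {ω : BondConfig (Fin n) | (A.card + 1) / 2 ≤ (T.filter fun v => ω ∉ openConn v a₀).card} ≤ c * δ)
    (hδ₀ : ∀ a ∈ A, (prodBernoulli w).real (openConn a a₀ : Set (BondConfig (Fin n)))ᶜ ≤ δ₀) :
    (prodBernoulli w).real (⋃ a ∈ A, openConn o a) - (1 + c) * δ₀ ≤
      (prodBernoulli w).real {ω : BondConfig (Fin n) | ω ∈ openConn o a₀ ∧
          A.card < 2 * (A.filter fun a => ω ∈ openConn o a).card} := by
  have hδ₀0 : 0 ≤ δ₀ := le_trans measureReal_nonneg (hδ₀ a₀ ha₀)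
  by_cases hsmall : c * δ₀ ≤ 1
  · have h := majorityGluing_harris_of_cellConst w A o a₀ δ₀ ha₀ hA c hc1 hcell hδ₀ hsmall
    have : δ₀ + c * δ₀ * (1 - δ₀) ≤ (1 + c) * δ₀ := by nlinarith [mul_nonneg hδ₀0 hδ₀0]
    linarith
  · have h1 : (prodBernoulli w).real (⋃ a ∈ A, openConn o a) ≤ 1 := measureReal_le_one
    have h0 : 0 ≤ (prodBernoulli w).real {ω : BondConfig (Fin n) | ω ∈ openConn o a₀ ∧
        A.card < 2 * (A.filter fun a => ω ∈ openConn o a).card} := measureReal_nonneg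
    push Not at hsmall
    nlinarith

/-! ### `|A| ∈ {8, 9}`: the root cell `R_4 = (6,4)` with constant `4/3` -/

/-- **The cells of `|A| ∈ {8, 9}` obey the constant bound `(4/3)·δ`:** the cell `(6,4)` is `fourOfSix_count` (van den Berg–Kahn), and the cell
`(7,5)` follows by monotonicity (`cutCount_mono`: `{5 ≤ #cut of 7} ⊆ {4 ≤ #cut of any 6}`). [cite: VandenbergKahn2001, Thm 1.2 (p. 123)] -/
theorem cell_eight_nine (p : Sym2 (Fin n) → unitInterval) (A : Finset (Fin n)) (a₀ : Fin n) (h8 : 8 ≤ A.card) (h9 : A.card ≤ 9)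
    (T : Finset (Fin n)) (δ : ℝ) (haT : a₀ ∉ T) (_hTA : T ⊆ A) (hTcard : T.card + 2 = A.card) (_hδ : 0 ≤ δ)
    (hδT : ∀ v ∈ T, (prodBernoulli p).real (openConn v a₀ : Set (BondConfig (Fin n)))ᶜ ≤ δ) :
    (prodBernoulli p).real {ω : BondConfig (Fin n) | (A.card + 1) / 2 ≤ (T.filter fun v => ω ∉ openConn v a₀).card} ≤ 4 / 3 * δ :=
  cutCount_mono p a₀ 6 4 δ (4 / 3 * δ) (fun T₀ hT₀ _ hδT₀ => fourOfSix_count p a₀ T₀ hT₀ δ hδT₀) T ((A.card + 1) / 2)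
    (by omega) (by omega) haT hδT

/-- **MAJORITY GLUING AT `|A| ∈ {8, 9}` WITH LOSS `(7/3)·max`** (the tree had `5/2` and `12/5`, `majorityGluing_of_additiveGluing`): for every
weight function, observer `o`, hub `a₀ ∈ A`, `8 ≤ |A| ≤ 9` and `δ₀ ≥ max_{a∈A} μ(a ↮ a₀)`:  `μ(o ↔ A) − (7/3)δ₀ ≤ μ(o ↔ a₀ ∧ 2N > |A|)`.
[cite: VandenbergKahn2001, Thm 1.2 (p. 123)] [cite: KozmaNitzan2024, Conj. 1 (p. 3)] -/
theorem majorityGluing_card_eight_nine (w : Sym2 (Fin n) → unitInterval) (A : Finset (Fin n)) (o a₀ : Fin n) (δ₀ : ℝ)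
    (ha₀ : a₀ ∈ A) (h8 : 8 ≤ A.card) (h9 : A.card ≤ 9)
    (hδ₀ : ∀ a ∈ A, (prodBernoulli w).real (openConn a a₀ : Set (BondConfig (Fin n)))ᶜ ≤ δ₀) :
    (prodBernoulli w).real (⋃ a ∈ A, openConn o a) - 7 / 3 * δ₀ ≤
      (prodBernoulli w).real {ω : BondConfig (Fin n) | ω ∈ openConn o a₀ ∧
          A.card < 2 * (A.filter fun a => ω ∈ openConn o a).card} := by
  have h := majorityGluing_of_cellConst w A o a₀ δ₀ ha₀ (by omega) (4 / 3) (by norm_num)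
    (fun p _ T δ haT hTA hTcard hδ hδT => cell_eight_nine p A a₀ h8 h9 T δ haT hTA hTcard hδ hδT) hδ₀
  norm_num at h ⊢
  linarith

/-- **MAJORITY GLUING AT `|A| ∈ {8, 9}` WITH LOSS `δ₀ + (4/3)·δ₀·(1 − δ₀)`** for `max_{a∈A} μ(a ↮ a₀) ≤ δ₀ ≤ 3/4` (van den Berg–Kahn + Harris +
closure; strictly better than `(7/3)·δ₀` for every `δ₀ > 0`). [cite: VandenbergKahn2001, Thm 1.2 (p. 123)] [cite: KozmaNitzan2024, Conj. 1 (p. 3)] -/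
theorem majorityGluing_harris_card_eight_nine (w : Sym2 (Fin n) → unitInterval) (A : Finset (Fin n)) (o a₀ : Fin n) (δ₀ : ℝ)
    (ha₀ : a₀ ∈ A) (h8 : 8 ≤ A.card) (h9 : A.card ≤ 9)
    (hδ₀ : ∀ a ∈ A, (prodBernoulli w).real (openConn a a₀ : Set (BondConfig (Fin n)))ᶜ ≤ δ₀) (hδ₀' : δ₀ ≤ 3 / 4) :
    (prodBernoulli w).real (⋃ a ∈ A, openConn o a) -
        (prodBernoulli w).real {ω : BondConfig (Fin n) | ω ∈ openConn o a₀ ∧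
          A.card < 2 * (A.filter fun a => ω ∈ openConn o a).card}
      ≤ δ₀ + 4 / 3 * δ₀ * (1 - δ₀) :=
  majorityGluing_harris_of_cellConst w A o a₀ δ₀ ha₀ (by omega) (4 / 3) (by norm_num)
    (fun p _ T δ haT hTA hTcard hδ hδT => cell_eight_nine p A a₀ h8 h9 T δ haT hTA hTcard hδ hδT) hδ₀ (by linarith)

/-- **`C(8) = C(9) = 2` OUTSIDE THE SMALL-MARGINAL REGIME:** for every weight function, observer, hub `a₀ ∈ A`, `8 ≤ |A| ≤ 9` and
`δ₀ ≥ max_{a∈A} μ(a ↮ a₀)` with `δ₀ ≥ 1/4`:  `μ(o ↔ A) − 2δ₀ ≤ μ(o ↔ a₀ ∧ 2N > |A|)`.  The loss `2·max` at `|A| = 8, 9` (the root cell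
`R_4 = (6,4)`) thus remains open only for `max < 1/4`. [cite: VandenbergKahn2001, Thm 1.2 (p. 123)] [cite: KozmaNitzan2024, Conj. 1 (p. 3), Conj. 4 (p. 32)] -/
theorem majorityGluing_two_card_eight_nine_of_ge (w : Sym2 (Fin n) → unitInterval) (A : Finset (Fin n)) (o a₀ : Fin n) (δ₀ : ℝ)
    (ha₀ : a₀ ∈ A) (h8 : 8 ≤ A.card) (h9 : A.card ≤ 9)
    (hδ₀ : ∀ a ∈ A, (prodBernoulli w).real (openConn a a₀ : Set (BondConfig (Fin n)))ᶜ ≤ δ₀) (h14 : 1 / 4 ≤ δ₀) :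
    (prodBernoulli w).real (⋃ a ∈ A, openConn o a) - 2 * δ₀ ≤
      (prodBernoulli w).real {ω : BondConfig (Fin n) | ω ∈ openConn o a₀ ∧
          A.card < 2 * (A.filter fun a => ω ∈ openConn o a).card} :=
  majorityGluing_two_of_cellConst w A o a₀ δ₀ ha₀ (by omega) (4 / 3) (by norm_num)
    (fun p _ T δ haT hTA hTcard hδ hδT => cell_eight_nine p A a₀ h8 h9 T δ haT hTA hTcard hδ hδT) hδ₀ (by linarith)

end HubOnly

end Summit.CriticalPhenomena.PercolationContinuityZ3.Theorems

end
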